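import Summits.AtomisticToContinuum.Crystallization.Theorems.TwoCentreKissingKernelRobustTangencyBoundRhombusSystem
import Summits.AtomisticToContinuum.Crystallization.Theorems.TwoCentreKissingKernelRobustTangencyBoundRhombus
import HarnessLib

/-!
# `RobustTangencyBound` — no isolated soft rhombus (robust Bezdek–Reid Lemma 4; step (III))

Route `TwoCentreKissingKernel`, item `stmt-AtomisticToContinuum-12082`, blueprint (III) §5–6.  The geometric
translation feeding the kernel certificates `rhombusClaim_holds` (`…RhombusCert.lean`): in the hull
of a finite set `X` of unit vectors with `0 ∈ interior (conv X)`, distinct points at inner product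
`≤ 1/2 + 2η`, let `v a w c ∈ X` span a soft rhombus — `⟪v,a⟫, ⟪a,w⟫, ⟪w,c⟫, ⟪c,v⟫ ≥ 1/2 − 3η`, with
`{v, w, a}` and `{v, w, c}` facets (so `{v, w}` is the long hull edge).  If every OTHER facet through
`v` and every other facet through `a` is a soft triangle, we reach a contradiction
(`false_of_isolated_soft_rhombus`): the diagonal `x = ⟪v, w⟫`, the four sides and the cosines/sines
of the regular corners at `v` and `a` solve the system `rhombusClaim m_v m_a` inside its box
(`0 ≤ η ≤ 10⁻³`), which the certificates exclude (the algebraic layer is `…RhombusSystem.lean`).  Ingredients: `vertex_product_eq_one` (vertex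
conditions in product form), `ballFraction_dirCone_triangle` + `corner_package` (corners in forward
form `N/√D²`), `soft_corner_cos_sin_window` (regular corners), `soft_rhombus_diag_ge` (`x ≥ −0.3454`).
-/

noncomputable section

namespace Summit.AtomisticToContinuum.Crystallization.Theorems

open Real RealInnerProductSpace InnerProductGeometry Literature.Geometry.DiscreteGeometry
  Literature.Analysis.ValidatedNumerics Finset

/-! ### Windows -/

/-- Numerator and denominator windows of a soft-triangle corner (`0 ≤ η ≤ 10⁻³`):
`s − ab ∈ [0.2449, 0.2551]` and `D ∈ [0.747, 0.753]` for `a, b, s ∈ [1/2 − 3η, 1/2 + 2η]`,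
`D ≥ 0`, `D² = (1 − a²)(1 − b²)`. -/
theorem soft_corner_windows {a b s D η : ℝ} (hη0 : 0 ≤ η) (hη : η ≤ 1 / 1000)
    (ha1 : 1 / 2 - 3 * η ≤ a) (ha2 : a ≤ 1 / 2 + 2 * η) (hb1 : 1 / 2 - 3 * η ≤ b)
    (hb2 : b ≤ 1 / 2 + 2 * η) (hs1 : 1 / 2 - 3 * η ≤ s) (hs2 : s ≤ 1 / 2 + 2 * η) (hD0 : 0 ≤ D)
    (hD2 : D ^ 2 = (1 - a ^ 2) * (1 - b ^ 2)) :
    (2449 / 10000 ≤ s - a * b ∧ s - a * b ≤ 2551 / 10000) ∧ (747 / 1000 ≤ D ∧ D ≤ 753 / 1000) := by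
  have hL0 : (0 : ℝ) ≤ 1 / 2 - 3 * η := by linarith only [hη]
  have ha0 : 0 ≤ a := hL0.trans ha1
  have hb0 : 0 ≤ b := hL0.trans hb1
  have hab1 : (1 / 2 - 3 * η) * (1 / 2 - 3 * η) ≤ a * b := mul_le_mul ha1 hb1 hL0 ha0
  have hab2 : a * b ≤ (1 / 2 + 2 * η) * (1 / 2 + 2 * η) :=
    mul_le_mul ha2 hb2 hb0 (by linarith only [hη0])
  have hN1 : 2449 / 10000 ≤ s - a * b := by nlinarith only [hab2, hs1, hη0, hη]
  have hN2 : s - a * b ≤ 2551 / 10000 := by nlinarith only [hab1, hs2, hη0, hη]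
  have haq1 : (1 / 2 - 3 * η) ^ 2 ≤ a ^ 2 := pow_le_pow_left₀ hL0 ha1 2
  have haq2 : a ^ 2 ≤ (1 / 2 + 2 * η) ^ 2 := pow_le_pow_left₀ ha0 ha2 2
  have hbq1 : (1 / 2 - 3 * η) ^ 2 ≤ b ^ 2 := pow_le_pow_left₀ hL0 hb1 2
  have hbq2 : b ^ 2 ≤ (1 / 2 + 2 * η) ^ 2 := pow_le_pow_left₀ hb0 hb2 2
  have hU2 : (1 / 2 + 2 * η) ^ 2 ≤ 253 / 1000 := by nlinarith only [hη0, hη]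
  have hL2 : 247 / 1000 ≤ (1 / 2 - 3 * η) ^ 2 := by nlinarith only [hη0, hη]
  have h1a : 747 / 1000 ≤ 1 - a ^ 2 := by linarith only [haq2, hU2]
  have h1b : 747 / 1000 ≤ 1 - b ^ 2 := by linarith only [hbq2, hU2]
  have h2a : 1 - a ^ 2 ≤ 753 / 1000 := by linarith only [haq1, hL2]
  have h2b : 1 - b ^ 2 ≤ 753 / 1000 := by linarith only [hbq1, hL2]
  have hDl : (747 / 1000 : ℝ) * (747 / 1000) ≤ D ^ 2 := by
    rw [hD2]; exact mul_le_mul h1a h1b (by norm_num) (by linarith only [h1a])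
  have hDu : D ^ 2 ≤ (753 / 1000 : ℝ) * (753 / 1000) := by
    rw [hD2]; exact mul_le_mul h2a h2b (by linarith only [h1b]) (by norm_num)
  have hDl' : 747 / 1000 ≤ D := by
    by_contra h
    push Not at h
    have := mul_lt_mul'' h h hD0 hD0
    rw [pow_two] at hDl
    linarith only [this, hDl]
  have hDu' : D ≤ 753 / 1000 := by
    by_contra h
    push Not at h
    have := mul_lt_mul'' h h (by norm_num) (by norm_num)
    rw [pow_two] at hDu
    linarith only [this, hDu]
  exact ⟨⟨hN1, hN2⟩, hDl', hDu'⟩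

/-- **Cosine and sine windows of a soft-triangle corner.** For unit `y, u, w` whose three mutual
inner products lie in `[1/2 − 3η, 1/2 + 2η]` (`0 ≤ η ≤ 10⁻³`) and `φ = ∠(t_y u, t_y w)`:
`cos φ ∈ [0.3252, 0.3415]`, `sin φ ∈ [0.9398, 0.9457]`. -/
theorem soft_corner_cos_sin_window {y u w : EuclideanSpace ℝ (Fin 3)} (hy : ‖y‖ = 1)
    (hu : ‖u‖ = 1) (hw : ‖w‖ = 1) {η : ℝ} (hη0 : 0 ≤ η) (hη : η ≤ 1 / 1000)
    (hyu1 : 1 / 2 - 3 * η ≤ ⟪y, u⟫) (hyu2 : ⟪y, u⟫ ≤ 1 / 2 + 2 * η)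
    (hyw1 : 1 / 2 - 3 * η ≤ ⟪y, w⟫) (hyw2 : ⟪y, w⟫ ≤ 1 / 2 + 2 * η)
    (huw1 : 1 / 2 - 3 * η ≤ ⟪u, w⟫) (huw2 : ⟪u, w⟫ ≤ 1 / 2 + 2 * η) :
    (3252 / 10000 ≤ Real.cos (angle (perpTo y u) (perpTo y w)) ∧
      Real.cos (angle (perpTo y u) (perpTo y w)) ≤ 3415 / 10000) ∧
    (9398 / 10000 ≤ Real.sin (angle (perpTo y u) (perpTo y w)) ∧
      Real.sin (angle (perpTo y u) (perpTo y w)) ≤ 9457 / 10000) := by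
  have hyu : ⟪y, u⟫ ^ 2 < 1 := by nlinarith
  have hyw : ⟪y, w⟫ ^ 2 < 1 := by nlinarith
  obtain ⟨hD, hD2, hCD, hS0, hS2⟩ := corner_package hy hu hw hyu hyw
  set C := Real.cos (angle (perpTo y u) (perpTo y w))
  set S := Real.sin (angle (perpTo y u) (perpTo y w))
  set D := ‖tangentProj y u‖ * ‖tangentProj y w‖
  obtain ⟨⟨hN1, hN2⟩, hD1, hD2'⟩ :=
    soft_corner_windows hη0 hη hyu1 hyu2 hyw1 hyw2 huw1 huw2 hD.le hD2
  have hC1 : 3252 / 10000 ≤ C := by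
    by_contra h
    push Not at h
    have : C * D < 3252 / 10000 * (753 / 1000) := by
      rcases le_or_gt 0 C with hc | hc
      · calc C * D ≤ C * (753 / 1000) := mul_le_mul_of_nonneg_left hD2' hc
          _ < 3252 / 10000 * (753 / 1000) := by nlinarith only [h, hc]
      · calc C * D < 0 := mul_neg_of_neg_of_pos hc hD
          _ < 3252 / 10000 * (753 / 1000) := by norm_num
    linarith only [this, hCD, hN1]
  have hC2 : C ≤ 3415 / 10000 := by
    by_contra h
    push Not at h
    have : 3415 / 10000 * (747 / 1000) < C * D := by
      calc (3415 / 10000 : ℝ) * (747 / 1000) ≤ 3415 / 10000 * D := by nlinarith only [hD1]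
        _ < C * D := mul_lt_mul_of_pos_right h hD
    linarith only [this, hCD, hN2]
  refine ⟨⟨hC1, hC2⟩, ?_, ?_⟩
  · by_contra h
    push Not at h
    have hS2' : S ^ 2 < (9398 / 10000) ^ 2 := by
      have := mul_lt_mul'' h h hS0 hS0; rw [pow_two, pow_two]; exact this
    nlinarith only [hS2', hS2, hC2, hC1]
  · by_contra h
    push Not at h
    have hS2' : (9457 / 10000 : ℝ) ^ 2 < S ^ 2 := by
      have := mul_lt_mul'' h h (by norm_num) (by norm_num); rw [pow_two, pow_two]; exact this
    nlinarith only [hS2', hS2, hC2, hC1]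

/-! ### The theorem -/

/-- The corner angle of the facet `c` at the point `y`. -/
def cornerAngle (X : Finset (EuclideanSpace ℝ (Fin 3))) (c y : EuclideanSpace ℝ (Fin 3)) : ℝ :=
  2 * π * ballFraction (0 : EuclideanSpace ℝ (Fin 3)) (dirCone (argmaxCone (facetNormals X) c) y)

/-- A facet `c` is a **soft triangle at `y`** (tolerance `η`): its vertices are `y, p, q`, distinct,
with the three mutual inner products `≥ 1/2 − 3η`. -/
def SoftTriangleAt (η : ℝ) (X : Finset (EuclideanSpace ℝ (Fin 3))) (c y : EuclideanSpace ℝ (Fin 3)) :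
    Prop :=
  ∃ p q : EuclideanSpace ℝ (Fin 3), tightSet X c = {y, p, q} ∧ y ≠ p ∧ y ≠ q ∧ p ≠ q ∧
    1 / 2 - 3 * η ≤ ⟪y, p⟫ ∧ 1 / 2 - 3 * η ≤ ⟪y, q⟫ ∧ 1 / 2 - 3 * η ≤ ⟪p, q⟫

/-- The corner of a soft triangle at `y`: its cosine and sine lie in the windows
`[0.3252, 0.3415]`, `[0.9398, 0.9457]`, and its ball fraction exceeds `1/6`. -/
theorem window_of_softTriangleAt {X : Finset (EuclideanSpace ℝ (Fin 3))} (hX1 : ∀ z ∈ X, ‖z‖ = 1)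
    (h0 : (0 : EuclideanSpace ℝ (Fin 3)) ∈ interior (convexHull ℝ (X : Set (EuclideanSpace ℝ (Fin 3)))))
    {η : ℝ} (hη0 : 0 ≤ η) (hη : η ≤ 1 / 1000)
    (hsep : ∀ p ∈ X, ∀ q ∈ X, p ≠ q → ⟪p, q⟫ ≤ 1 / 2 + 2 * η)
    {c y : EuclideanSpace ℝ (Fin 3)} (hc : c ∈ facetNormals X) (hy : y ∈ X)
    (hT : SoftTriangleAt η X c y) :
    (InIvl ((3252 : ℚ) / 10000, (3415 : ℚ) / 10000) (Real.cos (cornerAngle X c y)) ∧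
      InIvl ((9398 : ℚ) / 10000, (9457 : ℚ) / 10000) (Real.sin (cornerAngle X c y))) ∧
    1 / 6 < ballFraction (0 : EuclideanSpace ℝ (Fin 3)) (dirCone (argmaxCone (facetNormals X) c) y) := by
  obtain ⟨p, q, hTs, hyp, hyq, hpq, h1, h2, h3⟩ := hT
  have hpX : p ∈ X := (mem_tightSet.1 (by rw [hTs]; simp : p ∈ tightSet X c)).1
  have hqX : q ∈ X := (mem_tightSet.1 (by rw [hTs]; simp : q ∈ tightSet X c)).1
  have hbf := ballFraction_dirCone_triangle hX1 h0 hc hTs hyp hyq hpq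
  have hangle : cornerAngle X c y = angle (perpTo y p) (perpTo y q) := by
    rw [cornerAngle, hbf]; field_simp
  rw [hangle, hbf]
  have hw := soft_corner_cos_sin_window (hX1 y hy) (hX1 p hpX) (hX1 q hqX) hη0 hη h1
    (hsep y hy p hpX hyp) h2 (hsep y hy q hqX hyq) h3 (hsep p hpX q hqX hpq)
  have hb := soft_corner_angle_bounds (hX1 y hy) (hX1 p hpX) (hX1 q hqX) hη0 hη h1
    (hsep y hy p hpX hyp) h2 (hsep y hy q hqX hyq) h3 (hsep p hpX q hqX hpq)
  refine ⟨?_, ?_⟩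
  · simp only [InIvl]
    push_cast
    exact ⟨⟨hw.1.1, hw.1.2⟩, hw.2.1, hw.2.2⟩
  · rw [lt_div_iff₀ (by positivity)]; linarith [hb.1]

/-- At most five soft-triangle corners fit around a vertex (each exceeds `π/3`). -/
theorem card_le_five_of_softTriangles {X : Finset (EuclideanSpace ℝ (Fin 3))} (hX1 : ∀ z ∈ X, ‖z‖ = 1)
    (h0 : (0 : EuclideanSpace ℝ (Fin 3)) ∈ interior (convexHull ℝ (X : Set (EuclideanSpace ℝ (Fin 3)))))
    {η : ℝ} (hη0 : 0 ≤ η) (hη : η ≤ 1 / 1000)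
    (hsep : ∀ p ∈ X, ∀ q ∈ X, p ≠ q → ⟪p, q⟫ ≤ 1 / 2 + 2 * η)
    {y : EuclideanSpace ℝ (Fin 3)} (hy : y ∈ X) {R : Finset (EuclideanSpace ℝ (Fin 3))}
    (hR : R ⊆ (facetNormals X).filter (fun c => ⟪c, y⟫ = 1))
    (hreg : ∀ c ∈ R, SoftTriangleAt η X c y) : R.card ≤ 5 := by
  classical
  by_contra hgt
  push Not at hgt
  have h1 : ∑ c ∈ R, ballFraction (0 : EuclideanSpace ℝ (Fin 3))
      (dirCone (argmaxCone (facetNormals X) c) y) ≤ 1 := by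
    rw [← sum_ballFraction_dirCone_vertex hX1 h0 hy]
    exact sum_le_sum_of_subset_of_nonneg hR fun _ _ _ => ballFraction_nonneg _ _
  have h2 : ∑ _c ∈ R, (1 / 6 : ℝ) < ∑ c ∈ R, ballFraction (0 : EuclideanSpace ℝ (Fin 3))
      (dirCone (argmaxCone (facetNormals X) c) y) := by
    refine sum_lt_sum_of_nonempty (card_pos.1 (by omega)) fun c hc => ?_
    exact (window_of_softTriangleAt hX1 h0 hη0 hη hsep (mem_filter.1 (hR hc)).1 hy (hreg c hc)).2
  rw [sum_const, nsmul_eq_mul] at h2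
  have : (6 : ℝ) ≤ R.card := by exact_mod_cast hgt
  linarith

/-- **No isolated soft rhombus** (robust Bezdek–Reid Lemma 4). See the module docstring. -/
theorem false_of_isolated_soft_rhombus {X : Finset (EuclideanSpace ℝ (Fin 3))}
    (hX1 : ∀ z ∈ X, ‖z‖ = 1)
    (h0 : (0 : EuclideanSpace ℝ (Fin 3)) ∈ interior (convexHull ℝ (X : Set (EuclideanSpace ℝ (Fin 3)))))
    {η : ℝ} (hη0 : 0 ≤ η) (hη : η ≤ 1 / 1000)
    (hsep : ∀ p ∈ X, ∀ q ∈ X, p ≠ q → ⟪p, q⟫ ≤ 1 / 2 + 2 * η)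
    {v a w c : EuclideanSpace ℝ (Fin 3)} (hv : v ∈ X) (ha : a ∈ X) (hw : w ∈ X) (hc : c ∈ X)
    (hva : v ≠ a) (hvw : v ≠ w) (hvc : v ≠ c) (haw : a ≠ w) (hac : a ≠ c) (hwc : w ≠ c)
    (s1l : 1 / 2 - 3 * η ≤ ⟪v, a⟫) (s2l : 1 / 2 - 3 * η ≤ ⟪a, w⟫) (s3l : 1 / 2 - 3 * η ≤ ⟪w, c⟫)
    (s4l : 1 / 2 - 3 * η ≤ ⟪c, v⟫)
    {c₁ c₂ : EuclideanSpace ℝ (Fin 3)} (hc₁ : c₁ ∈ facetNormals X) (hT₁ : tightSet X c₁ = {v, w, a})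
    (hc₂ : c₂ ∈ facetNormals X) (hT₂ : tightSet X c₂ = {v, w, c})
    (hregv : ∀ c' ∈ facetNormals X, ⟪c', v⟫ = 1 → c' ≠ c₁ → c' ≠ c₂ → SoftTriangleAt η X c' v)
    (hrega : ∀ c' ∈ facetNormals X, ⟪c', a⟫ = 1 → c' ≠ c₁ → SoftTriangleAt η X c' a) : False := by
  classical
  -- windows of the base quantities
  have s1u := hsep v hv a ha hva
  have s2u := hsep a ha w hw haw
  have s3u := hsep w hw c hc hwc
  have s4u := hsep c hc v hv hvc.symm
  have hxu : ⟪v, w⟫ ≤ 1 / 2 + 2 * η := hsep v hv w hw hvw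
  have hxl : -3454 / 10000 ≤ ⟪v, w⟫ := by
    have h := soft_rhombus_diag_ge (hX1 v hv) (hX1 a ha) (hX1 w hw) (hX1 c hc) (ε := 3 * η)
      (by linarith) (by linarith)
      (abs_le.2 ⟨by linarith, by linarith⟩) (abs_le.2 ⟨by linarith, by linarith⟩)
      (abs_le.2 ⟨by linarith, by linarith⟩) (abs_le.2 ⟨by linarith, by linarith⟩)
      (by linarith) (by linarith [hsep a ha c hc hac])
    linarith
  -- facets through `v` and `a`
  set Sv := (facetNormals X).filter (fun c' => ⟪c', v⟫ = 1) with hSv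
  have hvT₁ : v ∈ tightSet X c₁ := by rw [hT₁]; simp
  have hvT₂ : v ∈ tightSet X c₂ := by rw [hT₂]; simp
  have haT₁ : a ∈ tightSet X c₁ := by rw [hT₁]; simp
  have hc₁v : c₁ ∈ Sv := mem_filter.2 ⟨hc₁, (mem_tightSet.1 hvT₁).2⟩
  have hc₂v : c₂ ∈ Sv := mem_filter.2 ⟨hc₂, (mem_tightSet.1 hvT₂).2⟩
  have hc₁₂ : c₁ ≠ c₂ := by
    intro h
    have : a ∈ tightSet X c₂ := h ▸ haT₁
    rw [hT₂, mem_insert, mem_insert, mem_singleton] at this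
    rcases this with h | h | h
    · exact hva h.symm
    · exact haw h
    · exact hac h
  set Rv := (Sv.erase c₁).erase c₂ with hRv
  have hc₂v' : c₂ ∈ Sv.erase c₁ := mem_erase.2 ⟨fun h => hc₁₂ h.symm, hc₂v⟩
  have hRvsub : Rv ⊆ Sv := (erase_subset _ _).trans (erase_subset _ _)
  have hRvreg : ∀ c' ∈ Rv, SoftTriangleAt η X c' v := by
    intro c' hc'
    obtain ⟨h2, h1⟩ := mem_erase.1 hc'
    obtain ⟨h1', hS⟩ := mem_erase.1 h1
    obtain ⟨hF, hcy⟩ := mem_filter.1 hS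
    exact hregv c' hF hcy h1' h2
  set Sa := (facetNormals X).filter (fun c' => ⟪c', a⟫ = 1) with hSa
  have hc₁a : c₁ ∈ Sa := mem_filter.2 ⟨hc₁, (mem_tightSet.1 haT₁).2⟩
  set Ra := Sa.erase c₁ with hRa
  have hRasub : Ra ⊆ Sa := erase_subset _ _
  have hRareg : ∀ c' ∈ Ra, SoftTriangleAt η X c' a := by
    intro c' hc'
    obtain ⟨h1', hS⟩ := mem_erase.1 hc'
    obtain ⟨hF, hcy⟩ := mem_filter.1 hS
    exact hrega c' hF hcy h1'
  have hmv : Rv.toList.length ≤ 5 := by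
    rw [length_toList]; exact card_le_five_of_softTriangles hX1 h0 hη0 hη hsep hv hRvsub hRvreg
  have hma : Ra.toList.length ≤ 5 := by
    rw [length_toList]; exact card_le_five_of_softTriangles hX1 h0 hη0 hη hsep ha hRasub hRareg
  -- the corner functions and their windows
  have hwin_v : ∀ c' ∈ Rv.toList,
      InIvl ((3252 : ℚ) / 10000, (3415 : ℚ) / 10000) (Real.cos (cornerAngle X c' v)) ∧
      InIvl ((9398 : ℚ) / 10000, (9457 : ℚ) / 10000) (Real.sin (cornerAngle X c' v)) := fun c' hc' =>
    (window_of_softTriangleAt hX1 h0 hη0 hη hsep (mem_filter.1 (hRvsub (mem_toList.1 hc'))).1 hv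
      (hRvreg c' (mem_toList.1 hc'))).1
  have hwin_a : ∀ c' ∈ Ra.toList,
      InIvl ((3252 : ℚ) / 10000, (3415 : ℚ) / 10000) (Real.cos (cornerAngle X c' a)) ∧
      InIvl ((9398 : ℚ) / 10000, (9457 : ℚ) / 10000) (Real.sin (cornerAngle X c' a)) := fun c' hc' =>
    (window_of_softTriangleAt hX1 h0 hη0 hη hsep (mem_filter.1 (hRasub (mem_toList.1 hc'))).1 ha
      (hRareg c' (mem_toList.1 hc'))).1
  -- the vertex conditions in product form, split off the rhombus facets
  set z : EuclideanSpace ℝ (Fin 3) → EuclideanSpace ℝ (Fin 3) → ℂ :=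
    fun c' y => (Real.cos (cornerAngle X c' y) : ℂ) + (Real.sin (cornerAngle X c' y) : ℂ) * Complex.I
    with hz
  have hprod_v : z c₁ v * (z c₂ v * (Rv.toList.map fun c' => z c' v).prod) = 1 := by
    have h := vertex_product_eq_one hX1 h0 hv
    rw [← mul_prod_erase Sv _ hc₁v, ← mul_prod_erase (Sv.erase c₁) _ hc₂v'] at h
    rw [prod_map_toList]
    exact h
  have hprod_a : z c₁ a * (Ra.toList.map fun c' => z c' a).prod = 1 := by
    have h := vertex_product_eq_one hX1 h0 ha
    rw [← mul_prod_erase Sa _ hc₁a] at h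
    rw [prod_map_toList]
    exact h
  -- the three rhombus corners in forward form
  have hsq1 : ⟪v, a⟫ ^ 2 < 1 := by nlinarith
  have hsqx : ⟪v, w⟫ ^ 2 < 1 := by nlinarith
  have hsq4 : ⟪v, c⟫ ^ 2 < 1 := by rw [real_inner_comm]; nlinarith
  have hsq1' : ⟪a, v⟫ ^ 2 < 1 := by rw [real_inner_comm]; exact hsq1
  have hsq2 : ⟪a, w⟫ ^ 2 < 1 := by nlinarith
  have hθ₁v : cornerAngle X c₁ v = angle (perpTo v a) (perpTo v w) := by
    have hT : tightSet X c₁ = {v, a, w} := by rw [hT₁]; ext t; simp [or_comm]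
    rw [cornerAngle, ballFraction_dirCone_triangle hX1 h0 hc₁ hT hva hvw haw]; field_simp
  have hθ₂v : cornerAngle X c₂ v = angle (perpTo v w) (perpTo v c) := by
    rw [cornerAngle, ballFraction_dirCone_triangle hX1 h0 hc₂ hT₂ hvw hvc hwc]; field_simp
  have hθ₁a : cornerAngle X c₁ a = angle (perpTo a v) (perpTo a w) := by
    have hT : tightSet X c₁ = {a, v, w} := by rw [hT₁]; ext t; simp [or_comm, or_left_comm]
    rw [cornerAngle, ballFraction_dirCone_triangle hX1 h0 hc₁ hT hva.symm haw hvw]; field_simp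
  obtain ⟨hC1, hS1⟩ := corner_forward (hX1 v hv) (hX1 a ha) (hX1 w hw) hsq1 hsqx
  obtain ⟨hC2, hS2⟩ := corner_forward (hX1 v hv) (hX1 w hw) (hX1 c hc) hsqx hsq4
  obtain ⟨hCa, hSa⟩ := corner_forward (hX1 a ha) (hX1 v hv) (hX1 w hw) hsq1' hsq2
  -- the candidate point and the evaluation of the three rhombus corners
  obtain ⟨hp0, hp1, hp2, hp3, hp4⟩ := mkPt_base ⟪v, w⟫ ⟪v, a⟫ ⟪a, w⟫ ⟪w, c⟫ ⟪c, v⟫ Rv.toList Ra.toList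
    (fun c' => Real.cos (cornerAngle X c' v)) (fun c' => Real.sin (cornerAngle X c' v))
    (fun c' => Real.cos (cornerAngle X c' a)) (fun c' => Real.sin (cornerAngle X c' a))
  set pt := mkPt ⟪v, w⟫ ⟪v, a⟫ ⟪a, w⟫ ⟪w, c⟫ ⟪c, v⟫ Rv.toList Ra.toList
    (fun c' => Real.cos (cornerAngle X c' v)) (fun c' => Real.sin (cornerAngle X c' v))
    (fun c' => Real.cos (cornerAngle X c' a)) (fun c' => Real.sin (cornerAngle X c' a)) with hpt
  have hphi1 : zOf pt phi1R = z c₁ v := by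
    rw [phi1R, zOf_cornerR, hz]
    simp only [RExpr.eval, hp0, hp1, hp2, hθ₁v, hC1, hS1]
    push_cast
    ring_nf
  have hphi2 : zOf pt phi2R = z c₂ v := by
    rw [phi2R, zOf_cornerR, hz]
    have e : ⟪v, c⟫ = ⟪c, v⟫ := real_inner_comm _ _
    simp only [RExpr.eval, hp0, hp3, hp4, hθ₂v, hC2, hS2, e]
    push_cast
    ring_nf
  have hbeta : zOf pt betaR = z c₁ a := by
    rw [betaR, zOf_cornerR, hz]
    have e : ⟪a, v⟫ = ⟪v, a⟫ := real_inner_comm _ _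
    simp only [RExpr.eval, hp0, hp1, hp2, hθ₁a, hCa, hSa, e]
    push_cast
    ring_nf
  rw [← hphi1, ← hphi2] at hprod_v
  rw [← hbeta] at hprod_a
  -- the algebraic core
  refine rhombus_core_false hmv hma ?_ ?_ ?_ ?_ ?_ hwin_v hwin_a
    (fun c' _ => Real.sin_sq_add_cos_sq _) (fun c' _ => Real.sin_sq_add_cos_sq _) hprod_v hprod_a <;>
    simp only [InIvl] <;> push_cast <;> constructor <;> linarith

end Summit.AtomisticToContinuum.Crystallization.Theorems

end
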